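import Summits.ResolutionOfSingularities.ResolutionOfSingularities.Theorems.PurelyInseparableDim4ScopeBaseChange
import Mathlib.RingTheory.Ideal.GoingDown
import Mathlib.RingTheory.TensorProduct.MvPolynomial
import Mathlib.RingTheory.Flat.Stability
import HarnessLib
import HarnessLib.Audit.Tags

/-!
# Purely inseparable fourfolds — the coordinate scope goes DOWN: `InCoordinateScope` is geometric
# [OURS · counted 0 · commutative algebra about OUR frame's scope predicate, not about resolution]

Census cell «res-dim4-pi» (D-0157 DOOR 2), width seat `res-dim4-p-14`, brick PR-12p; completes
PR-12i (`ScopeBaseChange.inCoordinateScope_map`: in-scope goes UP).  Along a homomorphism of fields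
`f : k →+* K` the polynomial extension `k[x] → K[x]` is a FLAT base change (Mathlib:
`Algebra.IsPushout k (k[x]) K (K[x])`, `Module.Flat.isBaseChange`), hence satisfies GOING-DOWN
(`Algebra.HasGoingDown.of_flat`); so a minimal prime `Q` over `P·K[x]` (`P` prime in `k[x]`) contracts
to `P` (`comap_eq_of_mem_minimalPrimes_map`).  Consequently:

* **`inCoordinateScope_of_map`**: `InCoordinateScope q (F ⊗ K) → InCoordinateScope q F` — every
  minimal prime `P` of `J_q⁺(F)` inside `𝔪₀(k)` lifts to a minimal prime `Q` of `J_q⁺(F ⊗ K)` inside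
  `𝔪₀(K)` with `Q ∩ k[x] = P`; `Q = (x_S)K[x]` by hypothesis, so `P = (x_S)k[x]` (`comap_span_X`);
* **`inCoordinateScope_map_iff`** — with PR-12i: the Scope add-on's «COORDINATE-ONLY / in scope»
  label is GEOMETRIC (the same over the state's field, any extension, `K̄`), like ISOLATED (PR-12g).

Nothing here proves resolution of singularities in dimension ≥ 4 / characteristic `p`; counted 0;
AI work, weaker than expert review.
bears_on: LADDER-RESOLUTION:D157-DOOR2 (res-dim4-pi · PR-12p). Supports stmt-ResolutionOfSingularities-16155
(helper).
-/

set_option linter.dupNamespace false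

noncomputable section

namespace Summit.ResolutionOfSingularities.ResolutionOfSingularities.Theorems.PIDim4

namespace ScopeDescent

open MvPolynomial
open Literature.AlgebraicGeometry.Resolution

variable {k K : Type} [Field k] [Field K] (f : k →+* K)

/-! ## 1. Going-down for `k[x] → K[x]`: minimal primes over `P·K[x]` contract to `P` -/

/-- **Minimal primes over an extended prime contract back**: for `P` prime in `k[x₁..x₄]` and `Q` a
minimal prime over `P·K[x₁..x₄]`, `Q ∩ k[x] = P` (flat base change ⇒ going-down). [folklore] -/
theorem comap_eq_of_mem_minimalPrimes_map {P : Ideal (MvPolynomial (Fin 4) k)} (hP : P.IsPrime)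
    {Q : Ideal (MvPolynomial (Fin 4) K)} (hQ : Q ∈ (P.map (MvPolynomial.map f)).minimalPrimes) :
    Q.comap (MvPolynomial.map f) = P := by
  letI : Algebra k K := f.toAlgebra
  letI : Algebra (MvPolynomial (Fin 4) k) (MvPolynomial (Fin 4) K) := MvPolynomial.algebraMvPolynomial
  have halg : algebraMap (MvPolynomial (Fin 4) k) (MvPolynomial (Fin 4) K) = MvPolynomial.map f :=
    MvPolynomial.algebraMap_def
  haveI : Module.Flat (MvPolynomial (Fin 4) k) (MvPolynomial (Fin 4) K) :=
    Module.Flat.isBaseChange (R := k) (M := K) (S := MvPolynomial (Fin 4) k) (MvPolynomial (Fin 4) K)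
      (Algebra.IsPushout.out (R := k) (S := MvPolynomial (Fin 4) k) (R' := K)
        (S' := MvPolynomial (Fin 4) K))
  haveI hQp : Q.IsPrime := hQ.1.1
  haveI := hP
  have hPQ : P ≤ Q.under (MvPolynomial (Fin 4) k) := by
    rw [Ideal.under_def, halg, ← Ideal.map_le_iff_le_comap]
    exact hQ.1.2
  obtain ⟨P', hP'Q, hP'p, hP'over⟩ :=
    Ideal.exists_ideal_le_liesOver_of_le (p := P) (q := Q.under (MvPolynomial (Fin 4) k)) Q hPQ
  have hmap : P.map (MvPolynomial.map f) ≤ P' := by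
    rw [hP'over.over, Ideal.under_def, halg]
    exact Ideal.map_comap_le
  have hQP' : Q ≤ P' := hQ.2 ⟨hP'p, hmap⟩ hP'Q
  have hPQ' : P' = Q := le_antisymm hP'Q hQP'
  rw [← halg, ← Ideal.under_def, ← hPQ']
  exact hP'over.over.symm

/-- `(x_S)·K[x] ∩ k[x] = (x_S)`. [folklore] -/
theorem comap_span_X (S : Finset (Fin 4)) :
    (Ideal.span ((fun i => (X i : MvPolynomial (Fin 4) K)) '' (S : Set (Fin 4)))).comap (MvPolynomial.map f) =
      Ideal.span ((fun i => (X i : MvPolynomial (Fin 4) k)) '' (S : Set (Fin 4))) := by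
  apply le_antisymm
  · intro G hG
    rw [Ideal.mem_comap] at hG
    refine MvPolynomial.mem_ideal_span_X_image.mpr fun m hm => ?_
    have hm' : m ∈ (MvPolynomial.map f G).support := by
      rwa [MvPolynomial.support_map_of_injective G f.injective]
    exact MvPolynomial.mem_ideal_span_X_image.mp hG m hm'
  · rw [← ScopeBaseChange.map_span_X f S]
    exact Ideal.le_comap_map

/-! ## 2. The coordinate scope goes down -/

/-- **In-scope goes DOWN**: if every minimal prime of `J_q⁺(F ⊗ K)` inside `𝔪₀(K)` is a coordinate
ideal, the same holds for `J_q⁺(F)` inside `𝔪₀(k)`. [folklore] -/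
theorem inCoordinateScope_of_map {q : ℕ} {F : MvPolynomial (Fin 4) k}
    (h : InCoordinateScope q (MvPolynomial.map f F)) : InCoordinateScope q F := by
  intro P hP hPm
  haveI hPp : P.IsPrime := hP.1.1
  -- extend `P` and pick a minimal prime `Q` over `P·K[x]` inside `𝔪₀(K)`
  have hPe : P.map (MvPolynomial.map f) ≤ originIdeal K := by
    rw [← IsolationConverse.originIdeal_map f]
    exact Ideal.map_mono hPm
  haveI := IsolationConverse.isPrime_originIdeal K
  obtain ⟨Q, hQ, hQm⟩ := Ideal.exists_minimalPrimes_le hPe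
  have hQc : Q.comap (MvPolynomial.map f) = P := comap_eq_of_mem_minimalPrimes_map f hPp hQ
  -- `Q` is a minimal prime of `J_q⁺(F ⊗ K)`
  have hQJ : Q ∈ (singLocusIdeal q (MvPolynomial.map f F)).minimalPrimes := by
    refine ⟨⟨hQ.1.1, ?_⟩, fun Q' hQ' hQ'Q => ?_⟩
    · rw [IsolationConverse.singLocusIdeal_map]
      exact (Ideal.map_mono hP.1.2).trans hQ.1.2
    · haveI : Q'.IsPrime := hQ'.1
      have h1 : singLocusIdeal q F ≤ Q'.comap (MvPolynomial.map f) := by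
        rw [← Ideal.map_le_iff_le_comap, ← IsolationConverse.singLocusIdeal_map]
        exact hQ'.2
      have h2 : Q'.comap (MvPolynomial.map f) ≤ P := hQc ▸ Ideal.comap_mono hQ'Q
      have h3 : P ≤ Q'.comap (MvPolynomial.map f) := hP.2 ⟨Ideal.IsPrime.comap _, h1⟩ h2
      exact hQ.2 ⟨hQ'.1, Ideal.map_le_iff_le_comap.mpr h3⟩ hQ'Q
  obtain ⟨S, hS⟩ := h Q hQJ hQm
  exact ⟨S, by rw [← hQc, hS, comap_span_X]⟩

/-- **The coordinate scope is GEOMETRIC**: invariant under extension of the coefficient field, in both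
directions (UP = PR-12i `ScopeBaseChange.inCoordinateScope_map`). [folklore] -/
theorem inCoordinateScope_map_iff {q : ℕ} {F : MvPolynomial (Fin 4) k} :
    InCoordinateScope q (MvPolynomial.map f F) ↔ InCoordinateScope q F :=
  ⟨inCoordinateScope_of_map f, ScopeBaseChange.inCoordinateScope_map f⟩

/-- Hence a BLINDNESS witness (`¬ InCoordinateScope`) found over an extension field certifies blindness
over the state's own field, and conversely. [folklore] -/
theorem not_inCoordinateScope_map_iff {q : ℕ} {F : MvPolynomial (Fin 4) k} :
    ¬ InCoordinateScope q (MvPolynomial.map f F) ↔ ¬ InCoordinateScope q F :=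
  not_congr (inCoordinateScope_map_iff f)

end ScopeDescent

end Summit.ResolutionOfSingularities.ResolutionOfSingularities.Theorems.PIDim4

end
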